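import Mathlib.Order.Zorn
import Mathlib.Topology.Order.Compact
import Literature.Probability.RandomPlanarGeometry.ChordalCurveFamilyProofs
import Literature.Probability.RandomPlanarGeometry.SimpleCurves
import HarnessLib

/-!
# Tournament rigidity: stub `stub_tournamentRigidity` of line `hitting-tournament` for crux
# `CardySelfRefinement.LagHandOff` (stmt-CriticalPhenomena-10268)

Two curves `c₁ c₂ : Curve ℂ` with the same source, the same HITTING TOURNAMENT over a family `𝓕`
of closed targets and a family `𝓖` of locators separating the points of the targets (the ORDER
bits `hitParam F c₁ ≤ hitParam F' c₁ ↔ hitParam F c₂ ≤ hitParam F' c₂` and the LOCATION bits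
"the first-hitting point of `F` lies in `G`"), and which do not idle relative to `𝓕` (every
parameter interval is an interval of constancy or contains a first-hitting time in its interior),
define the same point of the Aizenman–Burchard curve space (`CurveClass.mk c₁ = CurveClass.mk c₂`).

Proof (deterministic real analysis, staircase coupling).
1. Location bits + separation: `c₁` meets `F ∈ 𝓕` iff `c₂` does, and then the first-hitting
   POINTS coincide (`hits_of_hits`, `apply_hitParam_eq`).
2. Order bits: the set `K = {(T₁ F, T₂ F) : F ∈ 𝓕} ⊆ I × I` of pairs of first-hitting times is a
   chain for the product order; extend it to a maximal chain `Γ` (`IsChain.exists_maxChain`).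
3. A maximal chain of `I × I` is closed, contains `(0,0)` and `(1,1)`, and the coordinate sum maps
   it onto `[0, 2]` (`exists_mem_sum_eq`: a missed value would sit in a gap `p < q` of `Γ`, and the
   point of the segment `[p, q]` with that sum could be added to `Γ`); inverting gives a monotone
   STAIRCASE `u ↦ (m₁ u, m₂ u) ∈ Γ` with `m₁ u + m₂ u = 2u` (`exists_staircase`), and such `mᵢ` are
   automatically `2`-Lipschitz with `mᵢ 0 = 0`, `mᵢ 1 = 1`.
4. No idling: `c₁ x = c₂ y` for every `(x, y) ∈ Γ` (`apply_eq_of_mem_maxChain`): the largest point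
   `p ≤ (x, y)` of `Γ` at which the curves agree exists by compactness, and no first-hitting time
   lies strictly between `p` and `(x, y)` (it would give a point of `K ⊆ Γ` strictly between), so
   both curves are constant there.
5. Hence `c₁ ∘ m₁ = c₂ ∘ m₂`, and `dist c₁ c₂ ≤ dist c₁ (c₁ ∘ m₁) + dist (c₂ ∘ m₂) c₂ = 0`
   by `Curve.dist_precomp_eq_zero` (`dist_eq_zero_of_staircase`).
-/

noncomputable section

open Filter Set Topology
open scoped unitInterval
open Literature.Probability.RandomPlanarGeometry

namespace Summit.CriticalPhenomena.CardyFormulaZ2.Cruxes.LagHandOff.HittingTournament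

/-! ### Maximal chains in the unit square and staircase parametrisations -/

/-- The closure of a chain of `I × I` (product order) is a chain: comparability is a closed
condition. -/
theorem isChain_closure {Γ : Set (I × I)} (hΓ : IsChain (· ≤ ·) Γ) :
    IsChain (· ≤ ·) (closure Γ) := by
  intro p hp q hq _
  have hC : IsClosed {x : (I × I) × (I × I) | x.1 ≤ x.2 ∨ x.2 ≤ x.1} :=
    (isClosed_le continuous_fst continuous_snd).union (isClosed_le continuous_snd continuous_fst)
  have hsub : Γ ×ˢ Γ ⊆ {x : (I × I) × (I × I) | x.1 ≤ x.2 ∨ x.2 ≤ x.1} := by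
    rintro ⟨a, b⟩ ⟨ha, hb⟩
    exact hΓ.total ha hb
  have hmem : (p, q) ∈ closure (Γ ×ˢ Γ) := by
    rw [closure_prod_eq]
    exact ⟨hp, hq⟩
  exact hC.closure_subset_iff.2 hsub hmem

/-- A maximal chain of `I × I` is closed. -/
theorem isClosed_of_isMaxChain {Γ : Set (I × I)} (hΓ : IsMaxChain (· ≤ ·) Γ) : IsClosed Γ := by
  have h : Γ = closure Γ := hΓ.2 (isChain_closure hΓ.1) subset_closure
  rw [h]
  exact isClosed_closure

/-- Two comparable points of `I × I` whose coordinate sums compare the other way are equal. -/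
theorem eq_of_le_of_sum_le {p q : I × I} (hpq : p ≤ q)
    (hsm : (q.1 : ℝ) + q.2 ≤ p.1 + p.2) : p = q := by
  have h1 : (p.1 : ℝ) ≤ q.1 := hpq.1
  have h2 : (p.2 : ℝ) ≤ q.2 := hpq.2
  exact Prod.ext (Subtype.ext (by linarith)) (Subtype.ext (by linarith))

/-- On a maximal chain of `I × I` the coordinate sum attains every value of `[0, 2]`: otherwise
the value is skipped across a gap `p < q` of the chain, and the point of the segment `[p, q]`
with that coordinate sum could be added to the chain. -/
theorem exists_mem_sum_eq {Γ : Set (I × I)} (hΓ : IsMaxChain (· ≤ ·) Γ) {v : ℝ}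
    (hv0 : 0 ≤ v) (hv2 : v ≤ 2) : ∃ p ∈ Γ, (p.1 : ℝ) + p.2 = v := by
  set sm : I × I → ℝ := fun p => (p.1 : ℝ) + p.2 with hsm
  have hsmc : Continuous sm := by fun_prop
  have hcl := isClosed_of_isMaxChain hΓ
  -- the part of the chain below level `v` and its largest element
  set P : Set (I × I) := {p | p ∈ Γ ∧ sm p ≤ v} with hP
  have hPc : IsCompact P := (hcl.inter (isClosed_le hsmc continuous_const)).isCompact
  have hPn : P.Nonempty := by
    refine ⟨⊥, hΓ.bot_mem, ?_⟩
    show ((0 : I) : ℝ) + ((0 : I) : ℝ) ≤ v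
    simpa using hv0
  obtain ⟨p, hpP, hpmax⟩ := hPc.exists_isMaxOn hPn hsmc.continuousOn
  -- the part of the chain above level `v` and its least element
  set Q : Set (I × I) := {q | q ∈ Γ ∧ v ≤ sm q} with hQ
  have hQc : IsCompact Q := (hcl.inter (isClosed_le continuous_const hsmc)).isCompact
  have hQn : Q.Nonempty := by
    refine ⟨⊤, hΓ.top_mem, ?_⟩
    show v ≤ ((1 : I) : ℝ) + ((1 : I) : ℝ)
    norm_num
    exact hv2
  obtain ⟨q, hqQ, hqmin⟩ := hQc.exists_isMinOn hQn hsmc.continuousOn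
  by_contra hne
  push Not at hne
  have hpv : sm p < v := lt_of_le_of_ne hpP.2 (hne p hpP.1)
  have hqv : v < sm q := lt_of_le_of_ne hqQ.2 fun h => hne q hqQ.1 h.symm
  -- every element of the chain is below `p` or above `q`
  have hsplit : ∀ r ∈ Γ, r ≤ p ∨ q ≤ r := by
    intro r hr
    rcases le_total (sm r) v with hrv | hrv
    · left
      rcases hΓ.1.total hr hpP.1 with h | h
      · exact h
      · exact (eq_of_le_of_sum_le h (hpmax ⟨hr, hrv⟩)).symm.le
    · right
      rcases hΓ.1.total hqQ.1 hr with h | h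
      · exact h
      · exact (eq_of_le_of_sum_le h (hqmin ⟨hr, hrv⟩)).ge
  have hpq : p ≤ q := by
    rcases hΓ.1.total hpP.1 hqQ.1 with h | h
    · exact h
    · have h1 : (q.1 : ℝ) ≤ p.1 := h.1
      have h2 : (q.2 : ℝ) ≤ p.2 := h.2
      exact absurd (hpv.trans hqv) (not_lt.2 (by simp only [sm]; linarith))
  have hp1 : (p.1 : ℝ) ≤ q.1 := hpq.1
  have hp2 : (p.2 : ℝ) ≤ q.2 := hpq.2
  -- the interpolated point of the segment `[p, q]` at level `v`
  set t : ℝ := (v - sm p) / (sm q - sm p) with ht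
  have hden : 0 < sm q - sm p := by linarith
  have ht0 : 0 ≤ t := div_nonneg (by linarith) hden.le
  have ht1 : t ≤ 1 := (div_le_one hden).2 (by linarith)
  have htsm : t * (sm q - sm p) = v - sm p := div_mul_cancel₀ _ hden.ne'
  have hr1 : (p.1 : ℝ) + t * (q.1 - p.1) ∈ I := by
    have a := mul_nonneg ht0 (sub_nonneg.2 hp1)
    have b := mul_le_of_le_one_left (sub_nonneg.2 hp1) ht1
    exact ⟨by linarith [unitInterval.nonneg p.1], by linarith [unitInterval.le_one q.1]⟩
  have hr2 : (p.2 : ℝ) + t * (q.2 - p.2) ∈ I := by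
    have a := mul_nonneg ht0 (sub_nonneg.2 hp2)
    have b := mul_le_of_le_one_left (sub_nonneg.2 hp2) ht1
    exact ⟨by linarith [unitInterval.nonneg p.2], by linarith [unitInterval.le_one q.2]⟩
  set r : I × I := (⟨_, hr1⟩, ⟨_, hr2⟩) with hr
  have hpr : p ≤ r := by
    constructor
    · show (p.1 : ℝ) ≤ p.1 + t * (q.1 - p.1)
      nlinarith [mul_nonneg ht0 (sub_nonneg.2 hp1)]
    · show (p.2 : ℝ) ≤ p.2 + t * (q.2 - p.2)
      nlinarith [mul_nonneg ht0 (sub_nonneg.2 hp2)]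
  have hrq : r ≤ q := by
    constructor
    · show (p.1 : ℝ) + t * (q.1 - p.1) ≤ q.1
      nlinarith [mul_le_of_le_one_left (sub_nonneg.2 hp1) ht1]
    · show (p.2 : ℝ) + t * (q.2 - p.2) ≤ q.2
      nlinarith [mul_le_of_le_one_left (sub_nonneg.2 hp2) ht1]
  have hsmr : sm r = v := by
    show ((p.1 : ℝ) + t * (q.1 - p.1)) + ((p.2 : ℝ) + t * (q.2 - p.2)) = v
    have : ((p.1 : ℝ) + t * (q.1 - p.1)) + ((p.2 : ℝ) + t * (q.2 - p.2)) =
        sm p + t * (sm q - sm p) := by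
      simp only [sm]; ring
    rw [this, htsm]
    ring
  -- `r` can be added to the chain, hence belongs to it: contradiction
  have hch : IsChain (· ≤ ·) (insert r Γ) :=
    hΓ.1.insert fun b hb _ => (hsplit b hb).elim (fun h => Or.inr (h.trans hpr))
      fun h => Or.inl (hrq.trans h)
  have hrΓ : r ∈ Γ := by
    rw [hΓ.2 hch (subset_insert _ _)]
    exact mem_insert _ _
  exact hne r hrΓ hsmr

/-- **Staircase parametrisation** of a maximal chain `Γ` of `I × I`: monotone maps
`m₁ m₂ : I → I` with `m₁ u + m₂ u = 2u` and `(m₁ u, m₂ u) ∈ Γ`. -/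
theorem exists_staircase {Γ : Set (I × I)} (hΓ : IsMaxChain (· ≤ ·) Γ) :
    ∃ m₁ m₂ : I → I, Monotone m₁ ∧ Monotone m₂ ∧ (∀ u, (m₁ u : ℝ) + m₂ u = 2 * u) ∧
      ∀ u, (m₁ u, m₂ u) ∈ Γ := by
  have key : ∀ u : I, ∃ p ∈ Γ, (p.1 : ℝ) + p.2 = 2 * u := fun u =>
    exists_mem_sum_eq hΓ (by linarith [unitInterval.nonneg u]) (by linarith [unitInterval.le_one u])
  choose M hMΓ hMsm using key
  have hmono : Monotone M := by
    intro u w huw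
    rcases hΓ.1.total (hMΓ u) (hMΓ w) with h | h
    · exact h
    · have h1 : ((M w).1 : ℝ) ≤ (M u).1 := h.1
      have h2 : ((M w).2 : ℝ) ≤ (M u).2 := h.2
      have hwu : (w : ℝ) ≤ u := by linarith [hMsm u, hMsm w]
      have huw' : (u : ℝ) ≤ w := huw
      have : u = w := Subtype.ext (le_antisymm huw' hwu)
      subst this
      exact le_rfl
  exact ⟨fun u => (M u).1, fun u => (M u).2, fun u w h => (hmono h).1, fun u w h => (hmono h).2,
    hMsm, fun u => hMΓ u⟩

/-- **Staircase coupling.** If two curves agree along a monotone staircase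
`u ↦ (m₁ u, m₂ u)` with `m₁ u + m₂ u = 2u` (so that each `mᵢ` is a `2`-Lipschitz monotone
surjection of `[0, 1]`), they are at reparametrisation distance `0`: `c₁ ∘ m₁ = c₂ ∘ m₂` and
`cᵢ ∘ mᵢ` is at distance `0` from `cᵢ` (`Curve.dist_precomp_eq_zero`). -/
theorem dist_eq_zero_of_staircase {E : Type*} [PseudoMetricSpace E] (c₁ c₂ : Curve E)
    (m₁ m₂ : I → I) (h₁ : Monotone m₁) (h₂ : Monotone m₂)
    (hsum : ∀ u, (m₁ u : ℝ) + m₂ u = 2 * u) (heq : ∀ u, c₁ (m₁ u) = c₂ (m₂ u)) :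
    dist c₁ c₂ = 0 := by
  -- each `mᵢ` is `2`-Lipschitz, hence continuous
  have lip : ∀ f g : I → I, Monotone f → Monotone g → (∀ u, (f u : ℝ) + g u = 2 * u) →
      Continuous f := by
    intro f g hf hg hs
    refine (LipschitzWith.of_dist_le_mul (K := 2) fun u w => ?_).continuous
    rw [Subtype.dist_eq, Subtype.dist_eq, Real.dist_eq, Real.dist_eq, NNReal.coe_ofNat]
    rcases le_total u w with huw | hwu
    · have a : (f u : ℝ) ≤ f w := hf huw
      have b : (g u : ℝ) ≤ g w := hg huw
      have hu := hs u
      have hw := hs w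
      have huw' : (u : ℝ) ≤ w := huw
      rw [abs_of_nonpos (by linarith), abs_of_nonpos (by linarith)]
      linarith
    · have a : (f w : ℝ) ≤ f u := hf hwu
      have b : (g w : ℝ) ≤ g u := hg hwu
      have hu := hs u
      have hw := hs w
      have hwu' : (w : ℝ) ≤ u := hwu
      rw [abs_of_nonneg (by linarith), abs_of_nonneg (by linarith)]
      linarith
  have h0 : ∀ f g : I → I, (∀ u, (f u : ℝ) + g u = 2 * u) → f 0 = 0 := by
    intro f g hs
    have h := hs 0
    have a := unitInterval.nonneg (f 0)
    have b := unitInterval.nonneg (g 0)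
    simp only [Set.Icc.coe_zero, mul_zero] at h
    exact Subtype.ext (by simp only [Set.Icc.coe_zero]; linarith)
  have h1 : ∀ f g : I → I, (∀ u, (f u : ℝ) + g u = 2 * u) → f 1 = 1 := by
    intro f g hs
    have h := hs 1
    have a := unitInterval.le_one (f 1)
    have b := unitInterval.le_one (g 1)
    simp only [Set.Icc.coe_one, mul_one] at h
    exact Subtype.ext (by simp only [Set.Icc.coe_one]; linarith)
  have hsum' : ∀ u, (m₂ u : ℝ) + m₁ u = 2 * u := fun u => by rw [add_comm]; exact hsum u
  set M₁ : C(I, I) := ⟨m₁, lip m₁ m₂ h₁ h₂ hsum⟩ with hM₁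
  set M₂ : C(I, I) := ⟨m₂, lip m₂ m₁ h₂ h₁ hsum'⟩ with hM₂
  have hpre : c₁.precomp M₁ = c₂.precomp M₂ := by
    ext u
    exact heq u
  have d₁ : dist (c₁.precomp M₁) c₁ = 0 :=
    Curve.dist_precomp_eq_zero c₁ M₁ h₁ (h0 m₁ m₂ hsum) (h1 m₁ m₂ hsum)
  have d₂ : dist (c₂.precomp M₂) c₂ = 0 :=
    Curve.dist_precomp_eq_zero c₂ M₂ h₂ (h0 m₂ m₁ hsum') (h1 m₂ m₁ hsum')
  refine le_antisymm ?_ dist_nonneg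
  calc dist c₁ c₂ ≤ dist c₁ (c₁.precomp M₁) + dist (c₁.precomp M₁) c₂ := dist_triangle _ _ _
    _ = 0 := by rw [dist_comm, d₁, hpre, d₂, add_zero]

/-! ### The hitting tournament -/

section Tournament

variable {𝓕 𝓖 : Set (Set ℂ)} {c₁ c₂ : Curve ℂ}

/-- Location bits and separation: if `c₂` meets a target `F ∈ 𝓕`, so does `c₁` (its
first-hitting point of `F` lies in a locator `G ⊆ F` around the first-hitting point of `c₂`). -/
theorem hits_of_hits (h𝓕 : ∀ F ∈ 𝓕, IsClosed F)
    (hsep : ∀ F ∈ 𝓕, ∀ z ∈ F, ∀ ε : ℝ, 0 < ε → ∃ G ∈ 𝓖, G ⊆ F ∧ G ⊆ Metric.closedBall z ε ∧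
      ∃ V : Set ℂ, IsOpen V ∧ z ∈ V ∧ V ∩ F ⊆ G)
    (hloc : ∀ F ∈ 𝓕, ∀ G ∈ 𝓖, G ⊆ F →
      (c₁ ⟨c₁.hitParam F, c₁.hitParam_mem_Icc F⟩ ∈ G ↔
        c₂ ⟨c₂.hitParam F, c₂.hitParam_mem_Icc F⟩ ∈ G))
    {F : Set ℂ} (hF : F ∈ 𝓕) (h₂ : ∃ t, c₂ t ∈ F) : ∃ t, c₁ t ∈ F := by
  have hz : c₂ ⟨c₂.hitParam F, c₂.hitParam_mem_Icc F⟩ ∈ F :=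
    Curve.apply_hitParam_mem (h𝓕 F hF) h₂
  obtain ⟨G, hG, hGF, -, V, -, hzV, hVG⟩ := hsep F hF _ hz 1 one_pos
  exact ⟨_, hGF ((hloc F hF G hG hGF).2 (hVG ⟨hzV, hz⟩))⟩

/-- Location bits and separation: the first-hitting POINTS of a target met by the curves
coincide (they lie in common locators of arbitrarily small diameter). -/
theorem apply_hitParam_eq (h𝓕 : ∀ F ∈ 𝓕, IsClosed F)
    (hsep : ∀ F ∈ 𝓕, ∀ z ∈ F, ∀ ε : ℝ, 0 < ε → ∃ G ∈ 𝓖, G ⊆ F ∧ G ⊆ Metric.closedBall z ε ∧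
      ∃ V : Set ℂ, IsOpen V ∧ z ∈ V ∧ V ∩ F ⊆ G)
    (hloc : ∀ F ∈ 𝓕, ∀ G ∈ 𝓖, G ⊆ F →
      (c₁ ⟨c₁.hitParam F, c₁.hitParam_mem_Icc F⟩ ∈ G ↔
        c₂ ⟨c₂.hitParam F, c₂.hitParam_mem_Icc F⟩ ∈ G))
    {F : Set ℂ} (hF : F ∈ 𝓕) (h₁ : ∃ t, c₁ t ∈ F) :
    c₁ ⟨c₁.hitParam F, c₁.hitParam_mem_Icc F⟩ = c₂ ⟨c₂.hitParam F, c₂.hitParam_mem_Icc F⟩ := by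
  have hz : c₁ ⟨c₁.hitParam F, c₁.hitParam_mem_Icc F⟩ ∈ F :=
    Curve.apply_hitParam_mem (h𝓕 F hF) h₁
  refine (eq_of_forall_dist_le fun ε hε => ?_).symm
  obtain ⟨G, hG, hGF, hGball, V, -, hzV, hVG⟩ := hsep F hF _ hz ε hε
  exact hGball ((hloc F hF G hG hGF).1 (hVG ⟨hzV, hz⟩))

/-- A first-hitting time strictly less than `1` is the first-hitting time of a target that is
actually met. -/
theorem hits_of_hitParam_lt {c : Curve ℂ} {F : Set ℂ} {t : I} (h : c.hitParam F < (t : ℝ)) :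
    ∃ u, c u ∈ F := by
  by_contra hno
  push Not at hno
  rw [Curve.hitParam_eq_one_of_forall_notMem hno] at h
  exact absurd h (not_lt.2 (unitInterval.le_one t))

/-- **Agreement along a maximal chain through the tournament.** If `Γ` is a maximal chain of
`I × I` containing all pairs `(T₁ F, T₂ F)` of first-hitting times, then `c₁ x = c₂ y` for every
`(x, y) ∈ Γ`: take the largest point `p ≤ (x, y)` of `Γ` at which the curves agree (compactness);
by no idling the curves are constant on `[p₁, x]` and `[p₂, y]`, since a first-hitting time
strictly inside would produce a point of `Γ` strictly between `p` and `(x, y)`. -/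
theorem apply_eq_of_mem_maxChain (h𝓕 : ∀ F ∈ 𝓕, IsClosed F)
    (hsep : ∀ F ∈ 𝓕, ∀ z ∈ F, ∀ ε : ℝ, 0 < ε → ∃ G ∈ 𝓖, G ⊆ F ∧ G ⊆ Metric.closedBall z ε ∧
      ∃ V : Set ℂ, IsOpen V ∧ z ∈ V ∧ V ∩ F ⊆ G)
    (hsrc : c₁.source = c₂.source)
    (hni₁ : ∀ s t : I, s < t → (∀ u ∈ Set.Icc s t, c₁ u = c₁ s) ∨
      ∃ F ∈ 𝓕, (s : ℝ) < c₁.hitParam F ∧ c₁.hitParam F < (t : ℝ))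
    (hni₂ : ∀ s t : I, s < t → (∀ u ∈ Set.Icc s t, c₂ u = c₂ s) ∨
      ∃ F ∈ 𝓕, (s : ℝ) < c₂.hitParam F ∧ c₂.hitParam F < (t : ℝ))
    (hloc : ∀ F ∈ 𝓕, ∀ G ∈ 𝓖, G ⊆ F →
      (c₁ ⟨c₁.hitParam F, c₁.hitParam_mem_Icc F⟩ ∈ G ↔
        c₂ ⟨c₂.hitParam F, c₂.hitParam_mem_Icc F⟩ ∈ G))
    {Γ : Set (I × I)} (hΓ : IsMaxChain (· ≤ ·) Γ)
    (hKΓ : ∀ F ∈ 𝓕, ((⟨c₁.hitParam F, c₁.hitParam_mem_Icc F⟩ : I),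
      (⟨c₂.hitParam F, c₂.hitParam_mem_Icc F⟩ : I)) ∈ Γ)
    {x : I × I} (hx : x ∈ Γ) : c₁ x.1 = c₂ x.2 := by
  have hcl := isClosed_of_isMaxChain hΓ
  -- the points of `Γ` below `x` at which the curves agree, and the largest one
  set P : Set (I × I) := {a | a ∈ Γ ∧ a ≤ x ∧ c₁ a.1 = c₂ a.2} with hP
  have hPcl : IsClosed P := by
    refine hcl.inter ((isClosed_le continuous_id continuous_const).inter ?_)
    exact isClosed_eq (c₁.continuous.comp continuous_fst) (c₂.continuous.comp continuous_snd)
  have hPn : P.Nonempty := ⟨⊥, hΓ.bot_mem, bot_le, hsrc⟩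
  set sm : I × I → ℝ := fun p => (p.1 : ℝ) + p.2 with hsm
  have hsmc : Continuous sm := by fun_prop
  obtain ⟨p, hpP, hpmax⟩ := hPcl.isCompact.exists_isMaxOn hPn hsmc.continuousOn
  have hPle : ∀ a ∈ P, a ≤ p := fun a ha => by
    rcases hΓ.1.total ha.1 hpP.1 with h | h
    · exact h
    · exact (eq_of_le_of_sum_le h (hpmax ha)).symm.le
  obtain ⟨-, hpx, hpeq⟩ := hpP
  -- `c₁` is constant on `[p.1, x.1]`
  have e₁ : c₁ x.1 = c₁ p.1 := by
    rcases hpx.1.eq_or_lt with h | h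
    · rw [h]
    · rcases hni₁ p.1 x.1 h with hc | ⟨F, hF, hF1, hF2⟩
      · exact hc x.1 ⟨h.le, le_rfl⟩
      · exfalso
        have hhit : ∃ u, c₁ u ∈ F := hits_of_hitParam_lt hF2
        rcases hΓ.1.total (hKΓ F hF) hx with hle | hle
        · have hle' := (hPle _ ⟨hKΓ F hF, hle, apply_hitParam_eq h𝓕 hsep hloc hF hhit⟩).1
          exact absurd hF1 (not_lt.2 hle')
        · exact absurd hF2 (not_lt.2 hle.1)
  -- `c₂` is constant on `[p.2, x.2]`
  have e₂ : c₂ x.2 = c₂ p.2 := by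
    rcases hpx.2.eq_or_lt with h | h
    · rw [h]
    · rcases hni₂ p.2 x.2 h with hc | ⟨F, hF, hF1, hF2⟩
      · exact hc x.2 ⟨h.le, le_rfl⟩
      · exfalso
        have hhit : ∃ u, c₁ u ∈ F := hits_of_hits h𝓕 hsep hloc hF (hits_of_hitParam_lt hF2)
        rcases hΓ.1.total (hKΓ F hF) hx with hle | hle
        · have hle' := (hPle _ ⟨hKΓ F hF, hle, apply_hitParam_eq h𝓕 hsep hloc hF hhit⟩).2
          exact absurd hF1 (not_lt.2 hle')
        · exact absurd hF2 (not_lt.2 hle.2)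
  rw [e₁, e₂, hpeq]

end Tournament

/-- **Tournament rigidity** (stub `stub_tournamentRigidity` of line `hitting-tournament`, in tree
vocabulary): two curves with the same source, no idling relative to a family `𝓕` of closed
targets, and the same hitting tournament over `𝓕` and a family `𝓖` of locators separating the
points of the targets (first-hit ORDER bits on `𝓕 × 𝓕`, first-hit LOCATION bits against the
locators) define the same point of the curve space. Staircase coupling along a maximal chain
through the pairs of first-hitting times (see the module docstring). -/
theorem stub_tournamentRigidity :
    ∀ 𝓕 𝓖 : Set (Set ℂ), (∀ F ∈ 𝓕, IsClosed F) →
      (∀ F ∈ 𝓕, ∀ z ∈ F, ∀ ε : ℝ, 0 < ε → ∃ G ∈ 𝓖, G ⊆ F ∧ G ⊆ Metric.closedBall z ε ∧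
        ∃ V : Set ℂ, IsOpen V ∧ z ∈ V ∧ V ∩ F ⊆ G) →
      ∀ c₁ c₂ : Curve ℂ, c₁.source = c₂.source →
        (∀ s t : I, s < t → (∀ u ∈ Set.Icc s t, c₁ u = c₁ s) ∨
          ∃ F ∈ 𝓕, (s : ℝ) < c₁.hitParam F ∧ c₁.hitParam F < (t : ℝ)) →
        (∀ s t : I, s < t → (∀ u ∈ Set.Icc s t, c₂ u = c₂ s) ∨
          ∃ F ∈ 𝓕, (s : ℝ) < c₂.hitParam F ∧ c₂.hitParam F < (t : ℝ)) →
        ((∀ F ∈ 𝓕, ∀ F' ∈ 𝓕,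
            (c₁.hitParam F ≤ c₁.hitParam F' ↔ c₂.hitParam F ≤ c₂.hitParam F')) ∧
          (∀ F ∈ 𝓕, ∀ G ∈ 𝓖, G ⊆ F →
            (c₁ ⟨c₁.hitParam F, c₁.hitParam_mem_Icc F⟩ ∈ G ↔
              c₂ ⟨c₂.hitParam F, c₂.hitParam_mem_Icc F⟩ ∈ G))) →
        CurveClass.mk c₁ = CurveClass.mk c₂ := by
  intro 𝓕 𝓖 h𝓕 hsep c₁ c₂ hsrc hni₁ hni₂ htour
  obtain ⟨hord, hloc⟩ := htour
  rw [CurveClass.mk_eq_mk_iff_dist_eq_zero]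
  -- the chain of pairs of first-hitting times
  set K : Set (I × I) := (fun F => ((⟨c₁.hitParam F, c₁.hitParam_mem_Icc F⟩ : I),
    (⟨c₂.hitParam F, c₂.hitParam_mem_Icc F⟩ : I))) '' 𝓕 with hK
  have hKc : IsChain (· ≤ ·) K := by
    rintro _ ⟨F, hF, rfl⟩ _ ⟨F', hF', rfl⟩ _
    rcases le_total (c₁.hitParam F) (c₁.hitParam F') with h | h
    · exact Or.inl ⟨h, (hord F hF F' hF').1 h⟩
    · exact Or.inr ⟨h, (hord F' hF' F hF).1 h⟩
  obtain ⟨Γ, hΓ, hKΓ⟩ := hKc.exists_maxChain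
  obtain ⟨m₁, m₂, hm₁, hm₂, hsum, hmem⟩ := exists_staircase hΓ
  exact dist_eq_zero_of_staircase c₁ c₂ m₁ m₂ hm₁ hm₂ hsum fun u =>
    apply_eq_of_mem_maxChain h𝓕 hsep hsrc hni₁ hni₂ hloc hΓ (fun F hF => hKΓ ⟨F, hF, rfl⟩) (hmem u)

end Summit.CriticalPhenomena.CardyFormulaZ2.Cruxes.LagHandOff.HittingTournament
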